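import Mathlib
import Summits.KontsevichZagierPeriods.Zeta5Search.CatalanTwoAdicSeries
import HarnessLib

/-!
# Catalan box family — the defining series summed in `ℚ₂`: convergence and the lane's 2-adic constant `ξ`

HONEST FRAMING: systematic search; no irrationality claim unless certified.

Cell `pub-zeta5`, family-designer seat `fam-catalan` (`families/catalan/TWOADIC.md` §7–§11).  Continuation of
`CatalanTwoAdicSeries.lean` (Beta weights `t_μ = B(μ+1,½)`, exact valuation `v₂(t_μ) = 2μ+1−s₂(μ)`).
Here: the general term `t_μ/(μ+½) = 4^{μ+1}/((2μ+1)² binom(2μ,μ))` of the series whose REAL sum is `8G` has exact 2-adic valuation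
`2μ + 2 − s₂(μ) ≥ μ + 2` (`padicValRat_two_xiTerm`, `padicValRat_two_xiTerm_ge`), hence `‖·‖₂ ≤ 2^{-(μ+2)} → 0`
(`norm_xiTerm_le`, `tendsto_xiTerm`), hence the series is summable in the complete ultrametric field `ℚ₂`
(`summable_xiTerm`, via `NonarchimedeanAddGroup.summable_of_tendsto_cofinite_zero`).  We then DEFINE the lane's 2-adic constant
`xi := (1/8) Σ'_μ t_μ/(μ+½) ∈ ℚ_[2]` (`hasSum_xi`).  Numerically `ξ` agrees with the Kubota–Leopoldt value `ζ₂(2)` (Calegari 2005's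
"2-adic Catalan constant") to 1416 bits (zeta5-calc lane); that identification is NOT claimed here, and nothing in this file is an
irrationality statement.  The object `xi` is what the 2-adic coefficient law of TWOADIC §7 (`v₂(P_n + ξ·Q_n) = 2(j+l)n + 2 − s₂(jn) − s₂(ln)`)
is about; typing it is the purpose of this file.  0 sorry.
-/

open Finset

namespace Summit.KontsevichZagierPeriods.Zeta5Search.CatalanTwoAdicSeries

open Summit.KontsevichZagierPeriods.Zeta5Search.CatalanQSum (padicValNat_two_factorial)

/-! ### The series `Σ_μ t_μ/(μ+½)` in `ℚ₂` and the lane's 2-adic constant `ξ`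

In ℝ, `Σ_{μ≥0} t_μ/(μ+½) = 8G` (`G` = Catalan's constant; this is `S₁(0)` of the family's reduction).  The same series of rationals
converges in `ℚ₂` because `v₂(t_μ/(μ+½)) = 2μ + 2 − s₂(μ) → ∞`; its 2-adic sum divided by 8 is the constant `ξ` of
`families/catalan/TWOADIC.md` (numerically the Kubota–Leopoldt value `ζ₂(2)`; that identification is NOT claimed here). -/

/-- The general term `t_μ/(μ+½) = 4^{μ+1}/((2μ+1)² binom(2μ,μ))` as a rational number. -/
def xiTerm (μ : ℕ) : ℚ := tB μ / ((μ : ℚ) + 1 / 2)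

/-- The general term is non-zero. -/
theorem xiTerm_ne_zero (μ : ℕ) : xiTerm μ ≠ 0 := by
  unfold xiTerm
  exact div_ne_zero (tB_ne_zero μ) (by positivity)

/-- `v₂(μ + ½) = −1`. -/
theorem padicValRat_two_add_half (μ : ℕ) : padicValRat 2 ((μ : ℚ) + 1 / 2) = -1 := by
  have h : ((μ : ℚ) + 1 / 2) = ((2 * μ + 1 : ℕ) : ℚ) / 2 := by push_cast; ring
  rw [h, padicValRat.div (by positivity) (by norm_num), padicValRat.of_nat,
    padicValNat.eq_zero_of_not_dvd (by omega)]
  have hv2 : padicValRat 2 (2 : ℚ) = 1 := by simpa using padicValRat.self (p := 2) one_lt_two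
  rw [hv2]; norm_num

/-- **Exact valuation of the general term:** `v₂(t_μ/(μ+½)) = 2μ + 2 − s₂(μ)`. -/
theorem padicValRat_two_xiTerm (μ : ℕ) :
    padicValRat 2 (xiTerm μ) = 2 * (μ : ℤ) + 2 - ((Nat.digits 2 μ).sum : ℤ) := by
  unfold xiTerm
  rw [padicValRat.div (tB_ne_zero μ) (by positivity), padicValRat_two_tB, padicValRat_two_add_half]
  ring

/-- `s₂(μ) ≤ μ` (from Legendre: `v₂(μ!) = μ − s₂(μ) ≥ 0`). -/
theorem digits_two_sum_le (μ : ℕ) : ((Nat.digits 2 μ).sum : ℤ) ≤ μ := by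
  have h := padicValNat_two_factorial μ
  have h0 : (0 : ℤ) ≤ (padicValNat 2 μ.factorial : ℤ) := by positivity
  linarith

/-- Lower bound `v₂(t_μ/(μ+½)) ≥ μ + 2`. -/
theorem padicValRat_two_xiTerm_ge (μ : ℕ) : (μ : ℤ) + 2 ≤ padicValRat 2 (xiTerm μ) := by
  rw [padicValRat_two_xiTerm]; have := digits_two_sum_le μ; linarith

/-- The 2-adic norm of the general term: `‖t_μ/(μ+½)‖₂ ≤ 2^{-(μ+2)}`. -/
theorem norm_xiTerm_le (μ : ℕ) : ‖((xiTerm μ : ℚ) : ℚ_[2])‖ ≤ (2 : ℝ) ^ (-((μ : ℤ) + 2)) := by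
  rw [Padic.eq_padicNorm, padicNorm.eq_zpow_of_nonzero (xiTerm_ne_zero μ)]
  push_cast
  exact zpow_le_zpow_right₀ (by norm_num) (by have := padicValRat_two_xiTerm_ge μ; linarith)

/-- The general term tends to `0` in `ℚ₂`. -/
theorem tendsto_xiTerm : Filter.Tendsto (fun μ => ((xiTerm μ : ℚ) : ℚ_[2])) Filter.atTop (nhds 0) := by
  rw [tendsto_zero_iff_norm_tendsto_zero]
  have hb : Filter.Tendsto (fun μ : ℕ => (2 : ℝ) ^ (-((μ : ℤ) + 2))) Filter.atTop (nhds 0) := by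
    have h1 : Filter.Tendsto (fun μ : ℕ => ((1 : ℝ) / 2) ^ μ * (1 / 4)) Filter.atTop (nhds (0 * (1 / 4))) :=
      (tendsto_pow_atTop_nhds_zero_of_lt_one (by norm_num) (by norm_num)).mul_const _
    rw [zero_mul] at h1
    refine h1.congr fun μ => ?_
    rw [zpow_neg, zpow_add₀ (by norm_num : (2 : ℝ) ≠ 0), zpow_natCast, mul_inv, one_div, one_div, inv_pow]
    norm_num
  exact squeeze_zero (fun μ => norm_nonneg _) norm_xiTerm_le hb

/-- The series `Σ_μ t_μ/(μ+½)` is summable in `ℚ₂` (terms → 0 in a complete ultrametric field). -/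
theorem summable_xiTerm : Summable fun μ => ((xiTerm μ : ℚ) : ℚ_[2]) := by
  refine NonarchimedeanAddGroup.summable_of_tendsto_cofinite_zero ?_
  rw [Nat.cofinite_eq_atTop]
  exact tendsto_xiTerm

/-- The lane's 2-adic constant: `ξ := (1/8) Σ_{μ≥0} t_μ/(μ+½)` summed in `ℚ₂` (the real sum of the same series is `8G`). -/
noncomputable def xi : ℚ_[2] := (1 / 8 : ℚ_[2]) * ∑' μ, ((xiTerm μ : ℚ) : ℚ_[2])

/-- `Σ_μ t_μ/(μ+½) = 8ξ` in `ℚ₂` (by definition of `ξ`). -/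
theorem hasSum_xi : HasSum (fun μ => ((xiTerm μ : ℚ) : ℚ_[2])) (8 * xi) := by
  have h := summable_xiTerm.hasSum
  have : (8 : ℚ_[2]) * xi = ∑' μ, ((xiTerm μ : ℚ) : ℚ_[2]) := by
    unfold xi; rw [← mul_assoc]; norm_num
  rw [this]; exact h

/-- Sanity instance (kernel arithmetic): the valuations `v₂(t_μ/(μ+½))` for `μ = 0..5` are `2, 3, 5, 6, 9, 10`. -/
example : (List.range 6).map (fun μ : ℕ => 2 * (μ : ℤ) + 2 - ((Nat.digits 2 μ).sum : ℤ)) = [2, 3, 5, 6, 9, 10] := by decide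

end Summit.KontsevichZagierPeriods.Zeta5Search.CatalanTwoAdicSeries
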